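import Literature.NumberTheory.EllipticCurves.Kato2004.EulerSystemTatePairingValuesTwo
import HarnessLib

/-!
# Kato's matrix `ZetaBody` under a LEVEL-WISE rotation of the complex frame and under a `ℤ_pˣ`-rescaling of
# the value datum — the two invariances behind the audit of the «pinned-ι / X_B» turnkeys of the fact
# `exists_eulerSystem_expStar_tatePairing_values_two`

`Proofs`-style companion of `EulerSystemValues.lean` / `EulerSystemTatePairingValuesTwo.lean` (THEOREMS ONLY: no
definition, no named fact, no instance, no notation, no `sorry`).  Seat `bsd-input-ty-h` g0 (literature TYPER τ3 of
cell `pub/bsd-wall/bsd-inputs`, «inputs → unconditional», `--supports stmt-BirchSwinnertonDyer-22680`, helper).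
HONEST FRAMING: nothing here proves `F := exists_eulerSystem_expStar_tatePairing_values_two` (Kato's zeta elements with
the explicit reciprocity law at `2`, a published input of size XL); no `_holds`, no item closed; no summit statement
(`BirchSwinnertonDyer`) is proved or advanced by this file.

## What is proved (all elementary; the point is WHAT they certify, see «Why»)

* §1 tools on Kato's `σ_b` and character sums: `σ_a σ_b = σ_b σ_a`; `charSum (ι ∘ σ_a⁻¹… )`-transport
  (`charSum_sigma_of_comp_eq`: if `ι' ∘ σ_a = ι` then `Σ_b χ(b) ι'(σ_b σ_a x) = Σ_b χ(b) ι(σ_b x)`); every ring map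
  `ℚ(ζ_m) → ℂ` is determined by the image of `ζ_m`, two of them differ by a unique-up-to-existence `σ_a`
  (`exists_units_ringHom_comp_sigma_eq`), and the STANDARD one `ζ_m ↦ e^{2πi/m}` exists at every `m ≥ 1`
  (`exists_ringHom_cyclotomicField_zeta_eq_exp`) [Kato (5.7.1) p. 157: `ζ_N = e^{2πiN⁻¹}`, `σ_b ζ_N = ζ_N^b`]; and every
  `ψ : ℚ(ζ_m) → M` factors through any `φ : ℚ̄ → M` (`exists_algHom_cyclotomicField_comp_eq` — existence of the «frame» `j` with
  `φ ∘ j = ψ` that a faithful pinned-frame restatement of the defined-`exp*` fact needs; seat note INPUT-H-IOTA-PIN-XB-D-AUDIT §5).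
* §2 **`zetaBody_rotate`** — the rider (F-ι-0)/R-ι of `EulerSystemValues.lean` as a kernel theorem: for ANY family of units
  `a_{k,r} ∈ (ℤ/m(k,r))ˣ`, `ZetaBody W p f ι κ Λ c d a A z x` implies `ZetaBody W p f ι' κ Λ' c d a A z x'` with
  `Λ'_{k,r} = (1 ⊗ σ_{a_{k,r}}) ∘ Λ_{k,r}`, `x'_{k,r} = σ_{a_{k,r}} x_{k,r}` and ANY `ι'` with `ι'_m ∘ σ_{a} = ι_m` at the levels
  (classes `z`, constant `κ` untouched): (C1)/(C2) do not see `(ι, Λ, x)`, (C3a) because `Gal(ℚ(ζ_m)/ℚ)` is abelian, (C3b)/(C4)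
  are linear, (C5) by re-reading the character sum.  LEVEL-WISE: no coherence of `a` across levels is needed, because
  `ZetaBody` has no cross-level clause on `Λ` or `x`.
* §3 **`zetaBody_units_smul`** — `ZetaBody W p f ι κ Λ c d a A z x` implies `ZetaBody W p f ι κ (ν⁻¹ • Λ) c d a A (ν • z) x` for
  every `ν ∈ ℤ_pˣ` (SAME values `x`, same `ι`, same `κ`): (C1) `IsEulerSystem.smul`, (C2)–(C4) linear, (C5) untouched.
* §4 **`exists_eulerSystem_expStar_tatePairing_values_two_iff_allLevels`** — the fact `F` (complex frame pinned at the pure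
  `2`-power levels `ζ_{2^k} ↦ e^{2πi/2^k}` only, Kato (5.7.1)) is EQUIVALENT to its variant with the complex frame pinned at
  EVERY level `m(k, r) = 2^k ∏ ℓ` (`ζ_m ↦ e^{2πi/m}`): «⇐» rotates the tame levels by §2 (the value datum `ΛK` of `F` is
  abstract, so the rotated datum is again a witness; the pure levels, where (KZ) reads `x`, are not moved), «⇒» is
  instantiation.  So for `F` the freedom of `ιC` at the tame levels is immaterial — print's single frame suffices.

## Why (the audit these theorems serve; recorded, not asserted — evidence note of this seat on item 22680)

The reduction `exists_eulerSystem_expStar_tatePairing_values_two_of_definedExpStarBody : hK → hB → hIrr → F`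
(`EulerSystemTatePairingValuesTwoOfDefinedExpStar.lean`) displays two hypotheses whose value datum is the tree predicate
`DefinedExpStarBody` (the Bloch–Kato `exp*` read through `absGaloisRestrictTower ℚ ℚ_v ℚ(ζ_m)_{w₀}`, i.e. through the
CHOSEN embeddings `absClosureEmbedding` = `IsAlgClosed.lift`, one independent choice per completion type).  §3 shows that the
antecedent shared by `hK`/`hB` cannot pin the SCALE of the pair `(Λ, z)` beyond `ℤ_2ˣ` (the matrix is invariant under
`(Λ, z) ↦ (ν⁻¹Λ, νz)`; with `exp*` defined, `ν⁻¹ exp*_d = exp*_{ν d}`, `dualExpCoord_smul`), whereas the conclusion of `hB` fixes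
the scale up to `u ∈ ℚˣ`; §2/§4 show that for the ABSTRACT-datum fact `F` the complex frame away from the pure levels is free,
whereas for a DEFINED datum it is not (a rotation changes `Λ`).  The seat's note draws the consequences (which frame/scale
data a faithful «Kato with exp* defined» + «local pairing law» pair must share); this file asserts none of them.

## References

* K. Kato, Astérisque 295 (2004): (5.7.1) p. 157 (`ζ_N = e^{2πi/N}`, `σ_b`), Thm. 6.6 (1) p. 163 (the character sums),
  Thm. 9.7 p. 189, (8.1.3) p. 180, Ex. 13.3 p. 225, Thm. 12.5 (1) pp. 221–222. [Kato2004Asterisque]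
* K. Rubin, *Euler Systems* (2000), Def. 2.1.1 (Euler systems form a module: `IsEulerSystem.smul`). [Rubin2000]
* L. Washington, *Introduction to Cyclotomic Fields* (1997), §2 (embeddings of `ℚ(ζ_m)`, `Gal(ℚ(ζ_m)/ℚ) ≅ (ℤ/m)ˣ`). [Washington1997]
* Tree: `Kato2004/EulerSystemValues.lean` (`ZetaBody`, `sigma`, `charSum`, riders F-ι-0 / R-ι),
  `Kato2004/EulerSystemTatePairingValuesTwo.lean` (the fact `F`), `Kato2004/EulerSystemTatePairingValuesTwoProofs.lean`
  (`zetaBody_rat_smul`, the pattern of §3), `Kato2004/EulerSystemDefinedValues.lean` (`DefinedExpStarBody`).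
-/

noncomputable section

open scoped Classical NumberField TensorProduct
open Field IsDedekindDomain CongruenceSubgroup NumberField WeierstrassCurve Polynomial
open Literature.NumberTheory.GaloisRepresentations
open Literature.NumberTheory.EllipticCurves Literature.NumberTheory.EllipticCurves.ModularForms
open Literature.NumberTheory.EllipticCurves.Rank1Residual Literature.NumberTheory.EllipticCurves.Kobayashi2003
open Literature.NumberTheory.EllipticCurves.Kato2004.EulerSystemValues
open ZpExtension

namespace Literature.NumberTheory.EllipticCurves.Kato2004

/-! ## §1 Tools: Kato's `σ_b`, character sums, embeddings `ℚ(ζ_m) → ℂ` -/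

namespace EulerSystemValues

variable {m : ℕ} [NeZero m]

set_option backward.isDefEq.respectTransparency false in
/-- `σ_a σ_b = σ_b σ_a` on `ℚ(ζ_m)` (`Gal(ℚ(ζ_m)/ℚ) ≅ (ℤ/m)ˣ` is abelian; Kato (5.7.1): `σ_b ζ = ζ^b`).
[cite: Kato2004Asterisque, (5.7.1) (p. 157)] -/
theorem sigma_comm_apply (a b : (ZMod m)ˣ) (x : CyclotomicField m ℚ) :
    sigma m a (sigma m b x) = sigma m b (sigma m a x) := by
  unfold sigma
  rw [← AlgEquiv.mul_apply, ← map_mul, mul_comm, map_mul, AlgEquiv.mul_apply]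

set_option backward.isDefEq.respectTransparency false in
/-- **Transport of Kato's character sum along a rotation of the embedding**: if `ι' ∘ σ_a = ι` then
`Σ_b χ(b) ι'(σ_b (σ_a x)) = Σ_b χ(b) ι(σ_b x)`. [cite: Kato2004Asterisque, Thm. 6.6 (1) (p. 163)] -/
theorem charSum_sigma_of_comp_eq {ι ι' : CyclotomicField m ℚ →+* ℂ} {a : (ZMod m)ˣ}
    (h : ∀ y, ι' (sigma m a y) = ι y) (χ : DirichletCharacter ℂ m) (x : CyclotomicField m ℚ) :
    charSum m ι' χ (sigma m a x) = charSum m ι χ x := by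
  unfold charSum
  refine Finset.sum_congr rfl fun b _ => ?_
  rw [← sigma_comm_apply a b x, h]

set_option backward.isDefEq.respectTransparency false in
/-- A ring map `ℚ(ζ_m) → ℂ` is determined by the image of `ζ_m` (`ℚ(ζ_m) = ℚ[ζ_m]`, power basis).
[cite: Washington1997, Ch. 2 (the fields `ℚ(ζ_n)`)] -/
theorem ringHom_cyclotomicField_ext_zeta {ι ι' : CyclotomicField m ℚ →+* ℂ}
    (h : ι (IsCyclotomicExtension.zeta m ℚ (CyclotomicField m ℚ)) =
      ι' (IsCyclotomicExtension.zeta m ℚ (CyclotomicField m ℚ))) : ι = ι' := by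
  have hζ := IsCyclotomicExtension.zeta_spec m ℚ (CyclotomicField m ℚ)
  have hF : ι.toRatAlgHom = ι'.toRatAlgHom :=
    (hζ.powerBasis ℚ).algHom_ext (by rw [IsPrimitiveRoot.powerBasis_gen]; exact h)
  exact RingHom.ext fun y => congrArg (fun g : CyclotomicField m ℚ →ₐ[ℚ] ℂ => g y) hF

set_option backward.isDefEq.respectTransparency false in
/-- **Any two embeddings `ℚ(ζ_m) → ℂ` differ by Kato's `σ_a`**: `ι' ∘ σ_a = ι` for some unit `a` mod `m` (both `ι(ζ_m)`,
`ι'(ζ_m)` are primitive `m`-th roots of unity in `ℂ`). [cite: Washington1997, Ch. 2 (Thm. 2.5: `Gal(ℚ(ζ_n)/ℚ) ≅ (ℤ/nℤ)ˣ`)] -/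
theorem exists_units_ringHom_comp_sigma_eq (ι ι' : CyclotomicField m ℚ →+* ℂ) :
    ∃ a : (ZMod m)ˣ, ∀ y, ι' (sigma m a y) = ι y := by
  have hζ := IsCyclotomicExtension.zeta_spec m ℚ (CyclotomicField m ℚ)
  have hι : IsPrimitiveRoot (ι (IsCyclotomicExtension.zeta m ℚ (CyclotomicField m ℚ))) m :=
    hζ.map_of_injective ι.injective
  have hι' : IsPrimitiveRoot (ι' (IsCyclotomicExtension.zeta m ℚ (CyclotomicField m ℚ))) m :=
    hζ.map_of_injective ι'.injective
  obtain ⟨i, hi, hpow⟩ := hι'.eq_pow_of_pow_eq_one hι.pow_eq_one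
  have hcop : i.Coprime m := by
    have := (hι'.pow_iff_coprime (Nat.pos_of_ne_zero (NeZero.ne m)) i).1 (hpow ▸ hι)
    exact this
  refine ⟨ZMod.unitOfCoprime i hcop, fun y => ?_⟩
  have key : (ι'.comp (sigma m (ZMod.unitOfCoprime i hcop)).toAlgHom.toRingHom) = ι := by
    apply ringHom_cyclotomicField_ext_zeta
    rw [RingHom.comp_apply, AlgHom.toRingHom_eq_coe, AlgHom.coe_toRingHom, AlgEquiv.coe_toAlgHom,
      sigma_apply_zeta, map_pow, ZMod.coe_unitOfCoprime, ZMod.val_natCast, Nat.mod_eq_of_lt hi, hpow]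
  exact (congrArg (fun g : CyclotomicField m ℚ →+* ℂ => g y) key :)

set_option backward.isDefEq.respectTransparency false in
/-- **The standard complex embedding at every level**: `ι_m : ℚ(ζ_m) → ℂ` with `ι_m(ζ_m) = e^{2πi/m}` (`m ≥ 1`).
(Literature-side copy of the Summits-side `KatoBK.exists_ringHom_cyclotomicField_zeta_eq`.) [cite: Kato2004Asterisque, (5.7.1) (p. 157)] -/
theorem exists_ringHom_cyclotomicField_zeta_eq_exp (m : ℕ) [NeZero m] :
    ∃ ι : CyclotomicField m ℚ →+* ℂ,
      ι (IsCyclotomicExtension.zeta m ℚ (CyclotomicField m ℚ)) = Complex.exp (2 * Real.pi * Complex.I / m) := by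
  have hζ := IsCyclotomicExtension.zeta_spec m ℚ (CyclotomicField m ℚ)
  have hirr : Irreducible (cyclotomic m ℚ) := cyclotomic.irreducible_rat (NeZero.pos m)
  have hmem : Complex.exp (2 * Real.pi * Complex.I / m) ∈ primitiveRoots m ℂ := by
    rw [mem_primitiveRoots (NeZero.pos m)]
    exact Complex.isPrimitiveRoot_exp m (NeZero.ne m)
  refine ⟨((hζ.embeddingsEquivPrimitiveRoots ℂ hirr).symm ⟨_, hmem⟩).toRingHom, ?_⟩
  have h := hζ.embeddingsEquivPrimitiveRoots_apply_coe ℂ hirr ((hζ.embeddingsEquivPrimitiveRoots ℂ hirr).symm ⟨_, hmem⟩)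
  rw [Equiv.apply_symm_apply] at h
  exact h.symm

set_option backward.isDefEq.respectTransparency false in
/-- **Frame compatibility: every embedding of `ℚ(ζ_m)` factors through any copy of `ℚ̄`.**  For a `ℚ`-algebra map
`φ : ℚ̄ → M` into a field and any `ψ : ℚ(ζ_m) → M` there is `j : ℚ(ζ_m) → ℚ̄` with `φ ∘ j = ψ` (both `φ(j₀ ζ_m)` and `ψ(ζ_m)` are
primitive `m`-th roots of unity in `M`, so they differ by Kato's `σ_a`).  This is the existence of the «frame» `j` tying the complex /
`2`-adic embeddings of the level fields to the chosen embeddings of algebraic closures through which the tree's defined dual exponential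
(`DefinedExpStarBody`) reads its classes (take `φ = absClosureEmbedding ℚ_v L_{w₀} ∘ absClosureEmbedding ℚ ℚ_v`, `ψ = ℚ(ζ_m) → L_{w₀} → \overline{L_{w₀}}`).
[cite: Washington1997, Ch. 2 (Thm. 2.5: `Gal(ℚ(ζ_n)/ℚ) ≅ (ℤ/nℤ)ˣ`)] -/
theorem exists_algHom_cyclotomicField_comp_eq {M : Type*} [Field M] [Algebra ℚ M]
    (φ : AlgebraicClosure ℚ →ₐ[ℚ] M) (ψ : CyclotomicField m ℚ →ₐ[ℚ] M) :
    ∃ j : CyclotomicField m ℚ →ₐ[ℚ] AlgebraicClosure ℚ, ∀ y, φ (j y) = ψ y := by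
  have hζ := IsCyclotomicExtension.zeta_spec m ℚ (CyclotomicField m ℚ)
  let j₀ : CyclotomicField m ℚ →ₐ[ℚ] AlgebraicClosure ℚ := IsAlgClosed.lift
  have h₀ : IsPrimitiveRoot (φ (j₀ (IsCyclotomicExtension.zeta m ℚ (CyclotomicField m ℚ)))) m :=
    (hζ.map_of_injective j₀.injective).map_of_injective φ.injective
  have hψ : IsPrimitiveRoot (ψ (IsCyclotomicExtension.zeta m ℚ (CyclotomicField m ℚ))) m :=
    hζ.map_of_injective ψ.injective
  obtain ⟨i, hi, hpow⟩ := h₀.eq_pow_of_pow_eq_one hψ.pow_eq_one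
  have hcop : i.Coprime m := (h₀.pow_iff_coprime (Nat.pos_of_ne_zero (NeZero.ne m)) i).1 (hpow ▸ hψ)
  refine ⟨j₀.comp (sigma m (ZMod.unitOfCoprime i hcop) : CyclotomicField m ℚ →ₐ[ℚ] CyclotomicField m ℚ), ?_⟩
  have key : φ.comp (j₀.comp (sigma m (ZMod.unitOfCoprime i hcop) : CyclotomicField m ℚ →ₐ[ℚ] CyclotomicField m ℚ)) = ψ := by
    refine (hζ.powerBasis ℚ).algHom_ext ?_
    rw [IsPrimitiveRoot.powerBasis_gen, AlgHom.comp_apply, AlgHom.comp_apply, AlgEquiv.coe_toAlgHom, sigma_apply_zeta,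
      map_pow, map_pow, ZMod.coe_unitOfCoprime, ZMod.val_natCast, Nat.mod_eq_of_lt hi, hpow]
  exact fun y => (congrArg (fun g : CyclotomicField m ℚ →ₐ[ℚ] M => g y) key :)

end EulerSystemValues

/-! ## §1′ Tools on `ℚ_p ⊗_ℚ ℚ(ζ_m)`: the maps `1 ⊗ σ` -/

section Tensor

variable {p : ℕ} [Fact p.Prime] {K : Type*} [Field K] [Algebra ℚ K]

/-- `1 ⊗ σ` as a `ℚ_p`-algebra map agrees with `1 ⊗ σ` as a `ℚ`-algebra map (same underlying function). [folklore] -/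
private theorem map_idPadic_apply_eq (σ : K →ₐ[ℚ] K) (t : ℚ_[p] ⊗[ℚ] K) :
    Algebra.TensorProduct.map (AlgHom.id ℚ_[p] ℚ_[p]) σ t = Algebra.TensorProduct.map (AlgHom.id ℚ ℚ_[p]) σ t := by
  induction t using TensorProduct.induction_on with
  | zero => simp only [map_zero]
  | tmul s x => simp only [Algebra.TensorProduct.map_tmul, AlgHom.id_apply]
  | add x y hx hy => simp only [map_add, hx, hy]

/-- Two commuting `σ, τ` give commuting `1 ⊗ σ`, `1 ⊗ τ`. [folklore] -/
private theorem map_id_comm_apply (σ τ : K →ₐ[ℚ] K) (h : ∀ y, σ (τ y) = τ (σ y)) (t : ℚ_[p] ⊗[ℚ] K) :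
    Algebra.TensorProduct.map (AlgHom.id ℚ ℚ_[p]) σ (Algebra.TensorProduct.map (AlgHom.id ℚ ℚ_[p]) τ t) =
      Algebra.TensorProduct.map (AlgHom.id ℚ ℚ_[p]) τ (Algebra.TensorProduct.map (AlgHom.id ℚ ℚ_[p]) σ t) := by
  induction t using TensorProduct.induction_on with
  | zero => simp only [map_zero]
  | tmul s x => simp only [Algebra.TensorProduct.map_tmul, AlgHom.id_apply, h]
  | add x y hx hy => simp only [map_add, hx, hy]

/-- The left `ℚ_p`-action on `ℚ_p ⊗_ℚ K` commutes with `1 ⊗ σ`. [folklore] -/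
private theorem map_id_smul_apply (σ : K →ₐ[ℚ] K) (s : ℚ_[p]) (t : ℚ_[p] ⊗[ℚ] K) :
    Algebra.TensorProduct.map (AlgHom.id ℚ ℚ_[p]) σ (s • t) =
      s • Algebra.TensorProduct.map (AlgHom.id ℚ ℚ_[p]) σ t := by
  have hsmul : ∀ w : ℚ_[p] ⊗[ℚ] K, s • w = (s ⊗ₜ[ℚ] (1 : K)) * w := fun w => by
    rw [Algebra.smul_def]; rfl
  rw [hsmul, hsmul, map_mul, Algebra.TensorProduct.map_tmul, AlgHom.id_apply, map_one]

end Tensor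

/-! ## §2 Level-wise rotation of the complex frame -/

section Rotate

variable {W : WeierstrassCurve ℚ} [W.IsElliptic] {p : ℕ} [Fact p.Prime]
  [ContinuousSMul ℤ_[p] (W.tateModule p)] [Module.Free ℤ_[p] (W.tateModule p)]
  [Module.Finite ℤ_[p] (W.tateModule p)] {N : ℕ} {f : CuspForm (Gamma0 N) 2}
  {ι ι' : (m : ℕ) → (CyclotomicField m ℚ →+* ℂ)} {κ : ℝ}
  {Λ : ∀ (k : ℕ) (r : Finset (HeightOneSpectrum (𝓞 ℚ))),
    H1 (tateRep W p) (cycSubgroup p k r) →ₗ[ℤ_[p]] ℚ_[p] ⊗[ℚ] CyclotomicField (cycLevel p k r) ℚ}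
  {c d a : ℤ} {A : ℕ}
  {z : ∀ (k : ℕ) (r : (cyclotomicLevelsRat p (badPlaces c d A N)).Ideals),
    H1 (tateRep W p) ((cyclotomicLevelsRat p (badPlaces c d A N)).level k r.1)}
  {x : ∀ (k : ℕ) (r : (cyclotomicLevelsRat p (badPlaces c d A N)).Ideals),
    CyclotomicField (cycLevel p k r.1) ℚ}

set_option backward.isDefEq.respectTransparency false in
/-- **`ZetaBody` under a LEVEL-WISE rotation of the complex frame** (the rider F-ι-0 / R-ι of `EulerSystemValues.lean`,
kernel form).  For every family of units `b_{k,r} ∈ (ℤ/m(k,r))ˣ` and every family `ι'` with `ι'_m ∘ σ_{b} = ι_m` at the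
levels: `ZetaBody W p f ι κ Λ c d a A z x → ZetaBody W p f ι' κ ((1 ⊗ σ_b) ∘ Λ) c d a A z (σ_b x)`.  (C1)/(C2) untouched;
(C3a) since `σ_b σ_{χ(τ)} = σ_{χ(τ)} σ_b`; (C3b)/(C4) by linearity and `(1 ⊗ σ_b)(1 ⊗ x) = 1 ⊗ σ_b x`; (C5) since
`Σ_{b'} χ(b') ι'(σ_{b'} σ_b x) = Σ_{b'} χ(b') ι(σ_{b'} x)`.  NO coherence of `b` across levels is needed: the matrix has no
cross-level clause on `Λ` or `x` — which is exactly why the ABSTRACT-datum facts may pin or free `ι` at will, and why a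
DEFINED datum (`DefinedExpStarBody`, `Λ` pinned) may not. [cite: Kato2004Asterisque, (5.7.1) (p. 157), Thm. 6.6 (1) (p. 163), Thm. 9.7 (p. 189)] -/
theorem zetaBody_rotate (b : ∀ (k : ℕ) (r : Finset (HeightOneSpectrum (𝓞 ℚ))), (ZMod (cycLevel p k r))ˣ)
    (hι : ∀ (k : ℕ) (r : Finset (HeightOneSpectrum (𝓞 ℚ))) (y : CyclotomicField (cycLevel p k r) ℚ),
      ι' (cycLevel p k r) (sigma (cycLevel p k r) (b k r) y) = ι (cycLevel p k r) y)
    (hbody : ZetaBody W p f ι κ Λ c d a A z x) :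
    ZetaBody W p f ι' κ
      (fun k r => ((Algebra.TensorProduct.map (AlgHom.id ℚ_[p] ℚ_[p])
          (sigma (cycLevel p k r) (b k r) :
            CyclotomicField (cycLevel p k r) ℚ →ₐ[ℚ] CyclotomicField (cycLevel p k r) ℚ)).toLinearMap.restrictScalars ℤ_[p]) ∘ₗ
        Λ k r)
      c d a A z (fun k r => sigma (cycLevel p k r.1) (b k r.1) (x k r)) := by
  obtain ⟨h1, h2, h3a, h3b, h4, h5⟩ := hbody
  refine ⟨h1, h2, ?_, ?_, ?_, ?_⟩
  · intro k r σ y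
    rw [LinearMap.comp_apply, LinearMap.comp_apply, LinearMap.restrictScalars_apply, LinearMap.restrictScalars_apply,
      AlgHom.toLinearMap_apply, AlgHom.toLinearMap_apply, map_idPadic_apply_eq, map_idPadic_apply_eq, h3a k r σ y]
    exact map_id_comm_apply _ _ (fun w => sigma_comm_apply _ _ w) _
  · intro k r y hy
    rw [LinearMap.comp_apply, h3b k r y hy, map_zero]
  · intro k r
    rw [LinearMap.comp_apply, LinearMap.restrictScalars_apply, AlgHom.toLinearMap_apply, h4 k r,
      Algebra.TensorProduct.map_tmul, AlgHom.id_apply]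
    rfl
  · intro k r d' χ Lχ hcd hdd' hL
    obtain ⟨heven, hodd⟩ := h5 k r d' χ Lχ hcd hdd' hL
    exact ⟨fun hχ => by rw [charSum_sigma_of_comp_eq (hι k r.1), heven hχ],
      fun hχ => by rw [charSum_sigma_of_comp_eq (hι k r.1), hodd hχ]⟩

end Rotate

/-! ## §3 `ℤ_pˣ`-rescaling of the value datum against the classes -/

section UnitsSmul

variable {W : WeierstrassCurve ℚ} [W.IsElliptic] {p : ℕ} [Fact p.Prime]
  [ContinuousSMul ℤ_[p] (W.tateModule p)] [Module.Free ℤ_[p] (W.tateModule p)]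
  [Module.Finite ℤ_[p] (W.tateModule p)] {N : ℕ} {f : CuspForm (Gamma0 N) 2}
  {ι : (m : ℕ) → (CyclotomicField m ℚ →+* ℂ)} {κ : ℝ}
  {Λ : ∀ (k : ℕ) (r : Finset (HeightOneSpectrum (𝓞 ℚ))),
    H1 (tateRep W p) (cycSubgroup p k r) →ₗ[ℤ_[p]] ℚ_[p] ⊗[ℚ] CyclotomicField (cycLevel p k r) ℚ}
  {c d a : ℤ} {A : ℕ}
  {z : ∀ (k : ℕ) (r : (cyclotomicLevelsRat p (badPlaces c d A N)).Ideals),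
    H1 (tateRep W p) ((cyclotomicLevelsRat p (badPlaces c d A N)).level k r.1)}
  {x : ∀ (k : ℕ) (r : (cyclotomicLevelsRat p (badPlaces c d A N)).Ideals),
    CyclotomicField (cycLevel p k r.1) ℚ}

set_option backward.isDefEq.respectTransparency false in
/-- **`ZetaBody` is invariant under `(Λ, z) ↦ (ν⁻¹ • Λ, ν • z)`, `ν ∈ ℤ_pˣ`** — SAME values `x`, same frame `ι`, same `κ`.
(C1): Euler systems form a `ℤ_p`-module (`IsEulerSystem.smul`, Rubin Def. 2.1.1); (C2)–(C4) are `ℤ_p`-linear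
(`Λ(ν z) = ν Λ(z)`, `ν⁻¹ν = 1`); (C5) does not see `(Λ, z)`.  Read with `exp*` DEFINED (`ν⁻¹ • exp*_d = exp*_{ν • d}`,
`dualExpCoord_smul`): the matrix cannot tell Kato's class from a `2`-adic unit multiple of it with the correspondingly rescaled
generator — the datum «rational values `x`» does NOT pin the generator to a `ℚˣ`-class.
[cite: Rubin2000, Def. 2.1.1] [cite: Kato2004Asterisque, Thm. 9.7 (p. 189)] -/
theorem zetaBody_units_smul (ν : ℤ_[p]ˣ) (hbody : ZetaBody W p f ι κ Λ c d a A z x) :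
    ZetaBody W p f ι κ (fun k r => (((ν⁻¹ : ℤ_[p]ˣ) : ℤ_[p]) : ℚ_[p]) • Λ k r) c d a A ((ν : ℤ_[p]) • z) x := by
  obtain ⟨h1, h2, h3a, h3b, h4, h5⟩ := hbody
  refine ⟨h1.smul (ν : ℤ_[p]), ?_, ?_, ?_, ?_, h5⟩
  · intro k r v hv 𝔓 h𝔓
    rw [Pi.smul_apply, Pi.smul_apply, map_smul, h2 k r v hv 𝔓 h𝔓, smul_zero]
  · intro k r σ y
    rw [LinearMap.smul_apply, LinearMap.smul_apply, h3a k r σ y, map_id_smul_apply]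
  · intro k r y hy
    rw [LinearMap.smul_apply, h3b k r y hy, smul_zero]
  · intro k r
    rw [Pi.smul_apply, Pi.smul_apply, LinearMap.smul_apply, map_smul, h4 k r,
      ← IsScalarTower.algebraMap_smul ℚ_[p] (ν : ℤ_[p]), smul_smul, PadicInt.algebraMap_apply, ← PadicInt.coe_mul,
      Units.inv_mul, PadicInt.coe_one, one_smul]

end UnitsSmul


/-! ## §4 The fact `F` with the complex frame pinned at EVERY level is equivalent to `F` -/

section AllLevels

set_option backward.isDefEq.respectTransparency false in
/-- **`F` ⟺ `F` with the STANDARD complex embedding at every level `m(k, r) = 2^k ∏ ℓ`.**  The fact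
`exists_eulerSystem_expStar_tatePairing_values_two` pins `ιC` only at the pure `2`-power levels (where (KZ) reads the values)
and leaves it free at the tame levels; the variant below pins `ιC(ζ_m) = e^{2πi/m}` at all levels, as print does (Kato (5.7.1):
ONE frame `ℚ(ζ_N) ⊂ ℂ`, `ζ_N = e^{2πi/N}`).  «→»: instantiate.  «←»: apply the all-levels form at a standard family `S`
(`exists_ringHom_cyclotomicField_zeta_eq_exp`), then rotate every tame level back to the given `ιC` by `zetaBody_rotate`
with the units of `exists_units_ringHom_comp_sigma_eq` — the value datum `ΛK` of `F` is ABSTRACT, so the rotated datum is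
again a witness; at the pure levels `ιC = S` (both send `ζ_{2^k}` to `e^{2πi/2^k}`, `ringHom_cyclotomicField_ext_zeta`), the
rotation is the identity there and (KZ) is untouched.  Moral, recorded for the typer desk: for the ABSTRACT-datum fact the
tame-level freedom of `ιC` is immaterial; for a DEFINED datum (`DefinedExpStarBody`) a rotation changes `Λ` and is NOT available.
[cite: Kato2004Asterisque, (5.7.1) (p. 157), Thm. 6.6 (1) (p. 163), Thm. 9.7 (p. 189), Thm. 12.5 (1) (pp. 221–222)] -/
theorem exists_eulerSystem_expStar_tatePairing_values_two_iff_allLevels :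
    exists_eulerSystem_expStar_tatePairing_values_two ↔
    (
      ∀ (v : HeightOneSpectrum (𝓞 ℚ)), ((2 : ℕ) : 𝓞 ℚ) ∈ v.asIdeal →
      ∀ (W : WeierstrassCurve ℚ) [W.IsElliptic] [W.IsGloballyMinimal], GoodSS W 2 →
        ∀ (κ : ZpExtension ℚ 2) (hκ : κ.IsCyclotomic),
          ∀ [NeZero (W.conductorNorm ℤ)] (f : CuspForm (Gamma0 (W.conductorNorm ℤ)) 2), IsNewformOf W f →
          ∀ [ContinuousSMul ℤ_[2] (W.tateModule 2)] [Module.Free ℤ_[2] (W.tateModule 2)]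
            [Module.Finite ℤ_[2] (W.tateModule 2)],
          -- the `2`-adic completion frame: `Φ : ℚ̄₂ ≅ \overline{ℚ_v}` continuous, i.e. over `φ : ℚ₂ ≅ ℚ_v`
          ∀ (Φ : AlgebraicClosure ℚ_[2] ≃ₐ[ℚ] AlgebraicClosure (v.adicCompletion ℚ)) (φ : ℚ_[2] ≃+* v.adicCompletion ℚ),
            (∀ y : ℚ_[2], Φ (algebraMap ℚ_[2] (AlgebraicClosure ℚ_[2]) y) =
              algebraMap (v.adicCompletion ℚ) (AlgebraicClosure (v.adicCompletion ℚ)) (φ y)) →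
          ∀ (e : ∀ k : ℕ, CyclotomicField (cycLevel 2 k ∅) ℚ →ₐ[ℚ] PadicAlgCl 2)
            (τ : ∀ m : ℕ, ZMod (2 ^ m) → Field.absoluteGaloisGroup ℚ_[2]),
            -- the `2`-adic frame: a COHERENT tower `e_{k+1}(ζ_{2^{k+1}})² = e_k(ζ_{2^k})` with Galois lifts `τ_a : e_k(ζ) ↦ e_k(ζ)^a`
            (∀ k : ℕ, e (k + 1) (IsCyclotomicExtension.zeta (cycLevel 2 (k + 1) ∅) ℚ (CyclotomicField (cycLevel 2 (k + 1) ∅) ℚ)) ^ 2 =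
              e k (IsCyclotomicExtension.zeta (cycLevel 2 k ∅) ℚ (CyclotomicField (cycLevel 2 k ∅) ℚ))) →
            (∀ (k : ℕ) (a : ZMod (2 ^ k)), IsUnit a →
              τ k a • e k (IsCyclotomicExtension.zeta (cycLevel 2 k ∅) ℚ (CyclotomicField (cycLevel 2 k ∅) ℚ)) =
                e k (IsCyclotomicExtension.zeta (cycLevel 2 k ∅) ℚ (CyclotomicField (cycLevel 2 k ∅) ℚ)) ^ a.val) →
          -- the complex frame: the STANDARD embeddings at EVERY level `m(k, r)` (Kato (5.7.1))
          ∀ (ιC : (m : ℕ) → (CyclotomicField m ℚ →+* ℂ)),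
          (∀ (k : ℕ) (r : Finset (HeightOneSpectrum (𝓞 ℚ))),
            ιC (cycLevel 2 k r) (IsCyclotomicExtension.zeta (cycLevel 2 k r) ℚ (CyclotomicField (cycLevel 2 k r) ℚ)) =
              Complex.exp (2 * Real.pi * Complex.I / (cycLevel 2 k r : ℕ))) →
          ∃ κK : ℝ, κK ≠ 0 ∧
          ∃ ΛK : ∀ (k : ℕ) (r : Finset (HeightOneSpectrum (𝓞 ℚ))),
              H1 (tateRep W 2) (cycSubgroup 2 k r) →ₗ[ℤ_[2]] ℚ_[2] ⊗[ℚ] CyclotomicField (cycLevel 2 k r) ℚ,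
            ∀ (c d a : ℤ) (A : ℕ), 0 < A → Int.gcd c (6 * 2 * A) = 1 → Int.gcd d (6 * 2 * W.conductorNorm ℤ) = 1 →
              ∃ (z : ∀ (k : ℕ) (r : (cyclotomicLevelsRat 2 (badPlaces c d A (W.conductorNorm ℤ))).Ideals),
                    H1 (tateRep W 2) ((cyclotomicLevelsRat 2 (badPlaces c d A (W.conductorNorm ℤ))).level k r.1))
                (x : ∀ (k : ℕ) (r : (cyclotomicLevelsRat 2 (badPlaces c d A (W.conductorNorm ℤ))).Ideals),
                    CyclotomicField (cycLevel 2 k r.1) ℚ),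
                -- (C1)–(C5): Kato's Euler system with its dual-exponential values [Kato (8.1.3), 8.12, 9.7, 6.6 (1), Ex. 13.3]
                ZetaBody W 2 f ιC κK ΛK c d a A z x ∧
                -- (KZ): the pairing law on the layers [Kato Thm. 12.5 (1) ∘ Rubin §5 (2) / Kobayashi (8.29) / BK Ex. 3.10.1, 3.11]
                ∀ (n : ℕ) (Q₀ : localPoints W ℚ_[2])
                  (hQv : WeierstrassCurve.Affine.Point.map (W' := W)
                      (Φ : AlgebraicClosure ℚ_[2] →ₐ[ℚ] AlgebraicClosure (v.adicCompletion ℚ))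
                      (show (W.baseChange (AlgebraicClosure ℚ_[2])).toAffine.Point from Q₀) ∈
                    localLayerPointsOfEmb κ (closureEmb (K := ℚ) (v.adicCompletion ℚ)) W n),
                  (∀ (X Y : AlgebraicClosure ℚ_[2]) (hXY : (W.baseChange (AlgebraicClosure ℚ_[2])).toAffine.Nonsingular X Y),
                      (show (W.baseChange (AlgebraicClosure ℚ_[2])).toAffine.Point from Q₀) = .some X Y hXY → 1 < Valued.v X) →
                  ∃ t : ℤ_[2],
                    (∀ k : ℕ, CyclotomicLayer.tatePairingPk W κ v n k
                        (levelToLayerTwo W hκ (∅ : Set (HeightOneSpectrum (𝓞 ℚ))) n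
                          (z (n + 2) (cyclotomicLevelsRat 2 (badPlaces c d A (W.conductorNorm ℤ))).idealOne))
                        ⟨_, hQv⟩ = PadicInt.toZModPow k t) ∧
                    algebraMap ℚ_[2] (PadicAlgCl 2) (t : ℚ_[2]) =
                      ∑ b : (ZMod (2 ^ (n + 2)))ˣ, τ (n + 2) (b : ZMod (2 ^ (n + 2))) •
                        ((∑' i : ℕ, algebraMap ℚ_[2] (PadicAlgCl 2) (PowerSeries.coeff i (W.map (algebraMap ℚ ℚ_[2])).formalLog) *
                            (WeierstrassCurve.Affine.Point.zCoord
                              (show (W.baseChange (AlgebraicClosure ℚ_[2])).toAffine.Point from Q₀)) ^ i) *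
                          e (n + 2) (x (n + 2) (cyclotomicLevelsRat 2 (badPlaces c d A (W.conductorNorm ℤ))).idealOne))
    ) := by
  constructor
  · -- «→»: the all-levels pin implies the pure-levels pin
    intro hF v hv W _ _ hss κ hκ _ f hf _ _ _ Φ φ hΦφ e τ he hτ ιC hιC
    exact hF v hv W hss κ hκ f hf Φ φ hΦφ e τ he hτ ιC (fun k => hιC k ∅)
  · -- «←»: rotate the tame levels
    intro hall v hv W _ _ hss κ hκ _ f hf _ _ _ Φ φ hΦφ e τ he hτ ιC hιC
    -- a standard family at every level (`S 0 := ιC 0` is irrelevant: no level is `0`)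
    have hstd : ∀ m : ℕ, ∃ S : CyclotomicField m ℚ →+* ℂ, ∀ hm : NeZero m,
        S (IsCyclotomicExtension.zeta m ℚ (CyclotomicField m ℚ)) = Complex.exp (2 * Real.pi * Complex.I / m) := by
      intro m
      by_cases hm : m = 0
      · exact ⟨ιC m, fun h => absurd hm h.ne⟩
      · haveI : NeZero m := ⟨hm⟩
        obtain ⟨S, hS⟩ := exists_ringHom_cyclotomicField_zeta_eq_exp m
        exact ⟨S, fun _ => hS⟩
    choose S hS using hstd
    obtain ⟨κK, hκK, ΛK, hmain⟩ :=
      hall v hv W hss κ hκ f hf Φ φ hΦφ e τ he hτ S (fun k r => hS (cycLevel 2 k r) inferInstance)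
    -- the rotation units `ιC ∘ σ_b = S`
    have hrot : ∀ (k : ℕ) (r : Finset (HeightOneSpectrum (𝓞 ℚ))), ∃ b : (ZMod (cycLevel 2 k r))ˣ,
        ∀ y, ιC (cycLevel 2 k r) (sigma (cycLevel 2 k r) b y) = S (cycLevel 2 k r) y :=
      fun k r => exists_units_ringHom_comp_sigma_eq (S (cycLevel 2 k r)) (ιC (cycLevel 2 k r))
    choose b hb using hrot
    -- at the pure levels `ιC = S`, so the rotation is trivial
    have hpure : ∀ (k : ℕ) (w : CyclotomicField (cycLevel 2 k ∅) ℚ), sigma (cycLevel 2 k ∅) (b k ∅) w = w := by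
      intro k w
      have heq : ιC (cycLevel 2 k ∅) = S (cycLevel 2 k ∅) :=
        ringHom_cyclotomicField_ext_zeta (by rw [hιC k, hS (cycLevel 2 k ∅) inferInstance])
      exact (ιC (cycLevel 2 k ∅)).injective (by rw [hb, heq])
    refine ⟨κK, hκK, fun k r => ((Algebra.TensorProduct.map (AlgHom.id ℚ_[2] ℚ_[2])
        (sigma (cycLevel 2 k r) (b k r) :
          CyclotomicField (cycLevel 2 k r) ℚ →ₐ[ℚ] CyclotomicField (cycLevel 2 k r) ℚ)).toLinearMap.restrictScalars ℤ_[2]) ∘ₗ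
      ΛK k r, fun c d a A hA hc hd => ?_⟩
    obtain ⟨z, x, hbody, hKZ⟩ := hmain c d a A hA hc hd
    refine ⟨z, fun k r => sigma (cycLevel 2 k r.1) (b k r.1) (x k r), zetaBody_rotate b hb hbody,
      fun n Q₀ hQv hformal => ?_⟩
    obtain ⟨t, hres, ht⟩ := hKZ n Q₀ hQv hformal
    have hx : sigma (cycLevel 2 (n + 2) (cyclotomicLevelsRat 2 (badPlaces c d A (W.conductorNorm ℤ))).idealOne.1)
        (b (n + 2) (cyclotomicLevelsRat 2 (badPlaces c d A (W.conductorNorm ℤ))).idealOne.1)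
        (x (n + 2) (cyclotomicLevelsRat 2 (badPlaces c d A (W.conductorNorm ℤ))).idealOne) =
        x (n + 2) (cyclotomicLevelsRat 2 (badPlaces c d A (W.conductorNorm ℤ))).idealOne :=
      hpure (n + 2) _
    refine ⟨t, hres, ?_⟩
    rw [ht]
    simp only [hx]

end AllLevels

end Literature.NumberTheory.EllipticCurves.Kato2004

end
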